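import Summits.CriticalPhenomena.PercolationContinuityZ3.Theorems.Transplant.GrigorchukLamplighterSignPatterns
import Summits.CriticalPhenomena.PercolationContinuityZ3.Theorems.Transplant.GrigorchukLamplighterAutNotVirtuallyNilpotent
import Summits.CriticalPhenomena.PercolationContinuityZ3.Theorems.Transplant.GrigorchukLamplighterSubexponentialGrowth
import Summits.CriticalPhenomena.PercolationContinuityZ3.Theorems.Transplant.AutChartOrbitsOneLampAutSigns
import HarnessLib

/-!
# THE AUTOMORPHISM GROUP OF `Cay(ℤ ≀_X 𝔊; a, b, c, d, s)` EXACTLY: the vertex stabiliser IS the set of position-wise sign patterns, and every automorphism is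
# a left translation followed by a sign pattern (`P3-NILPOTENT.md` §29.2 as a theorem)

builds on p205010 (kernel theorem, internal audit signed; external expert review pending) — nothing in this file uses p205010; graph theory of ONE Cayley graph, no
percolation statement, no growth statement, nothing about any `@[conjecture]` or about `BenjaminiSchramm1996_conj4_endState`.  Lane `prim-bschramm`, seat
`prim-bschramm-gen-1` gen 9 (GEN pen; item (A) of lead g26's RULING 2026-08-28T10:30Z, p3 g37's nod; route named in p3 g36's HANDOFF).  DEF-FREE helper file
(`--supports stmt-CriticalPhenomena-4575 --as helper`); no instance declared (the tautological action `α • v = α v` of `Aut(Cay)` is Mathlib's `RelIso.applyMulAction`),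
no notation.  REUSES — nothing restated: S «GrigorchukLamplighterSignPatterns» p615754 (`flipW`, `flipAut`, `flipAut_one`, `flipW_mul_of_left_eq_one`,
`flipW_mul_sW`), F3 «GrigorchukLamplighterStandardGensNoSkeleton» p613235 (`frameW`, `labelAction_of_isActionByAut`, `treesW`, `trW`, `coe_conj_sW_of_mem_treesW`), F2
«AutChartOrbitsOneLampAutDefs/…AutSigns» p599738/p600197 (`LabelAction.sgn`, `smul_mul_tree`, `smul_mul_s`, `smul_mul_s_inv_eq`, `sgn_eq_or`, `sgn_eq_sgn_tr`,
`sgn_of_pos_eq`), F5a «GrigorchukLamplighterAutNotVirtuallyNilpotent» p615715 (`frameW_tr`), F-BE3 «GrigorchukLamplighterSubexponentialGrowth» p624625 (`exists_prodW_of_walk`,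
`cay_connected`), «CayleySkeletonSign» (`leftMulIso`).

THE THEOREMS.  For `α ∈ Aut(Cay)` let `sgn α v ∈ {±1}` be F2's sign of the lamp edge at `v` (label rigidity F2/F3: tree edges go to tree edges with the same letter,
the `s`-edge at `v` to the `s^{sgn}`-edge at `α v`).  By F2b the sign depends on the POSITION `v.right·ρ` only, so `P_α := {r | some tree element t with t·ρ = r has
sgn α t = −1}` satisfies `sgn α v = −1 ↔ P_α (v.right ρ)` (§1).  If `α 1 = 1`, induction along the letters of a word for `v` from the fixed vertex gives `α v = flipW P_α v`
(§2: tree letters by `smul_mul_tree` / `flipW_mul_of_left_eq_one`, the lamp letter by `smul_mul_s` / `flipW_mul_sW`, its inverse likewise), i.e.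
**`aut_eq_flipAut_of_map_one : α 1 = 1 → ∃ P, α = flipAut P`**; hence **`aut_eq_leftMul_flipAut : ∃ P, ∀ v, α v = α 1 * flipW P v`** for every `α`, and the
classification **`stabilizer_one_eq_range_flipAut : {α | α 1 = 1} = Set.range flipAut`** — 'Aut(Cay(ℤ ≀_X 𝔊; a,b,c,d,s)) = left translations by Γ₂ followed by the
position-wise lamp reflections', the theorem behind the descriptive sentence of VERDICTS :410.
[cite: BartholdiErschler2012, §2–§3.1 (the Cayley graph of the permutational wreath product)] [cite: BenjaminiSchramm1996, §2 (Cayley graphs and their automorphisms)]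
-/

noncomputable section

namespace Summit.CriticalPhenomena.PercolationContinuityZ3.Theorems.Transplant
namespace Grigorchuk

open SimpleGraph SemidirectProduct Literature.Probability.Percolation
open scoped Classical

/-! ### §1 The sign pattern of an automorphism -/

/-- The tautological action of `Aut(Cay)` on `Γ₂` (Mathlib's `RelIso.applyMulAction`, `α • v = α v`) is by automorphisms. [folklore] -/
theorem isActionByAut_aut : IsActionByAut Cay (Cay ≃g Cay) :=
  fun a _ _ => a.map_adj_iff

/-- The tree part `trW v` is a tree element with the same tree coordinate. [folklore] -/
theorem trW_mem_treesW (v : ↥wreathZ) : trW v ∈ treesW ∧ (((trW v : ↥wreathZ)) : LampGroup ℤ).right = ((v : LampGroup ℤ)).right :=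
  ⟨mem_treesW.2 (by simp [trW]), by simp [trW]⟩

/-- Tree elements with the same image of `ρ` have the same frame position `t s t⁻¹`. [cite: BartholdiErschler2012, §2 (positions = lamps at g·ρ)] -/
theorem frameW_pos_eq_of_right_rho_eq {t t' : ↥wreathZ} (ht : t ∈ treesW) (ht' : t' ∈ treesW)
    (h : ((t : LampGroup ℤ)).right rho = ((t' : LampGroup ℤ)).right rho) : frameW.pos t = frameW.pos t' := by
  unfold OneLampFrame.pos
  rw [(frameW_tr t).1, (frameW_tr t').1, frameW_H.2]
  have e1 : trW t = t := Subtype.ext (coe_eq_inr_of_mem_treesW ht).symm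
  have e2 : trW t' = t' := Subtype.ext (coe_eq_inr_of_mem_treesW ht').symm
  rw [e1, e2]
  exact Subtype.ext (by rw [coe_conj_sW_of_mem_treesW ht, coe_conj_sW_of_mem_treesW ht', h])

section Sign

variable {A : Type} [Group A] [MulAction A ↥wreathZ] (hA : frameW.LabelAction A) (α : A)

/-- **The sign is read off the position**: with `P_α r :≡ ∃ t ∈ treesW, t.right ρ = r ∧ sgn α t = −1`, `sgn α v = if P_α (v.right ρ) then −1 else 1` for EVERY vertex
`v` (F2b's `sgn_of_pos_eq` + `sgn_eq_sgn_tr`). [cite: BartholdiErschler2012, §2–§3.1] -/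
theorem sgn_eq_ite (v : ↥wreathZ) :
    hA.sgn α v = if (∃ t : ↥wreathZ, t ∈ treesW ∧ ((t : LampGroup ℤ)).right rho = ((v : LampGroup ℤ)).right rho ∧ hA.sgn α t = -1) then -1 else 1 := by
  obtain ⟨ht, hr⟩ := trW_mem_treesW v
  have hs : hA.sgn α v = hA.sgn α (trW v) := by rw [hA.sgn_eq_sgn_tr α v, (frameW_tr v).1]
  split_ifs with hP
  · obtain ⟨t, ht', htr, hsg⟩ := hP
    rw [hs, hA.sgn_of_pos_eq α (frameW_pos_eq_of_right_rho_eq ht ht' (by rw [hr]; exact htr.symm)), hsg]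
  · rcases hA.sgn_eq_or α (trW v) with h1 | h1
    · rw [hs, h1]
    · exact absurd ⟨trW v, ht, by rw [hr], h1⟩ hP

/-- The tree coordinate of `u·s⁻¹` is that of `u`. [folklore] -/
theorem right_mul_sW_inv (u : ↥wreathZ) : (((u * sW⁻¹ : ↥wreathZ)) : LampGroup ℤ).right = ((u : LampGroup ℤ)).right := by
  rw [Subgroup.coe_mul, Subgroup.coe_inv, mul_right, inv_right, coe_sW, lamp_right, inv_one, mul_one]

/-- **ONE LETTER**: if `α·u = flipW P_α u` then `α·(u y) = flipW P_α (u y)` for each of the six letters `y = a, b, c, d, s, s⁻¹`. [cite: BartholdiErschler2012, §2–§3.1] -/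
theorem smul_mul_letter_eq_flipW (u : ↥wreathZ)
    (hu : α • u = flipW (fun r => ∃ t : ↥wreathZ, t ∈ treesW ∧ ((t : LampGroup ℤ)).right rho = r ∧ hA.sgn α t = -1) u) (y : L6) :
    α • (u * y.toW) = flipW (fun r => ∃ t : ↥wreathZ, t ∈ treesW ∧ ((t : LampGroup ℤ)).right rho = r ∧ hA.sgn α t = -1) (u * y.toW) := by
  set P : Ray → Prop := fun r => ∃ t : ↥wreathZ, t ∈ treesW ∧ ((t : LampGroup ℤ)).right rho = r ∧ hA.sgn α t = -1 with hP
  have tree : ∀ t : ↥wreathZ, ((t : LampGroup ℤ)).left = 1 → α • (u * t) = flipW P (u * t) := fun t ht => by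
    rw [hA.smul_mul_tree α u t (show t ∈ frameW.H from frameW_H.1 ▸ mem_treesW.2 ht), hu, flipW_mul_of_left_eq_one P u ht]
  cases y
  · exact tree aW rfl
  · exact tree bW rfl
  · exact tree cW rfl
  · exact tree dW rfl
  · -- the lamp letter `s`
    show α • (u * sW) = flipW P (u * sW)
    have h1 : α • (u * sW) = α • u * sW ^ hA.sgn α u := hA.smul_mul_s α u
    rw [h1, hu, flipW_mul_sW, sgn_eq_ite hA α u]
  · -- the inverse lamp letter `s⁻¹`
    show α • (u * sW⁻¹) = flipW P (u * sW⁻¹)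
    have h1 : α • (u * sW⁻¹) = α • u * sW ^ (-hA.sgn α (u * sW⁻¹)) := hA.smul_mul_s_inv_eq α u
    have h2 := flipW_mul_sW P (u * sW⁻¹)
    rw [inv_mul_cancel_right, right_mul_sW_inv] at h2
    have h3 : flipW P (u * sW⁻¹) = flipW P u * (sW ^ (if P (((u : LampGroup ℤ)).right rho) then (-1 : ℤ) else 1))⁻¹ :=
      eq_mul_inv_of_mul_eq h2.symm
    rw [h1, hu, h3, sgn_eq_ite hA α (u * sW⁻¹), right_mul_sW_inv, ← zpow_neg]

/-- **ALL VERTICES**: if `α·1 = 1` then `α·v = flipW P_α v` for every `v` (induction along a word for `v` from the fixed vertex; `Cay` is connected).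
[cite: BartholdiErschler2012, §2–§3.1] -/
theorem smul_eq_flipW_of_smul_one (h1 : α • (1 : ↥wreathZ) = 1) (v : ↥wreathZ) :
    α • v = flipW (fun r => ∃ t : ↥wreathZ, t ∈ treesW ∧ ((t : LampGroup ℤ)).right rho = r ∧ hA.sgn α t = -1) v := by
  have key : ∀ (ys : List L6) (u : ↥wreathZ),
      α • u = flipW (fun r => ∃ t : ↥wreathZ, t ∈ treesW ∧ ((t : LampGroup ℤ)).right rho = r ∧ hA.sgn α t = -1) u →
      α • (u * prodW ys) = flipW (fun r => ∃ t : ↥wreathZ, t ∈ treesW ∧ ((t : LampGroup ℤ)).right rho = r ∧ hA.sgn α t = -1) (u * prodW ys) := by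
    intro ys
    induction ys with
    | nil => intro u hu; simpa [prodW] using hu
    | cons y ys ih =>
      intro u hu
      rw [prodW, ← mul_assoc]
      exact ih _ (smul_mul_letter_eq_flipW hA α u hu y)
  obtain ⟨p⟩ := cay_connected.preconnected (1 : ↥wreathZ) v
  obtain ⟨ys, -, hv⟩ := exists_prodW_of_walk p
  have h0 : α • (1 : ↥wreathZ) = flipW (fun r => ∃ t : ↥wreathZ, t ∈ treesW ∧ ((t : LampGroup ℤ)).right rho = r ∧ hA.sgn α t = -1) 1 := by
    rw [h1]; exact (flipAut_one _).symm
  have := key ys 1 h0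
  rwa [← hv] at this

end Sign

/-! ### §2 The classification -/

/-- **EVERY AUTOMORPHISM OF `Cay(ℤ ≀_X 𝔊; a,b,c,d,s)` FIXING THE BASE VERTEX IS A POSITION-WISE SIGN PATTERN.** [cite: BartholdiErschler2012, §2–§3.1] -/
theorem aut_eq_flipAut_of_map_one (α : Cay ≃g Cay) (h1 : α 1 = 1) : ∃ P : Ray → Prop, α = flipAut P := by
  have hA : frameW.LabelAction (Cay ≃g Cay) := labelAction_of_isActionByAut isActionByAut_aut
  exact ⟨_, RelIso.ext fun v => smul_eq_flipW_of_smul_one hA α h1 v⟩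

/-- **EVERY AUTOMORPHISM IS A LEFT TRANSLATION FOLLOWED BY A SIGN PATTERN**: `α v = α 1 · flipW P v` for one pattern `P` and all `v` (apply the previous theorem to
`v ↦ (α 1)⁻¹ · α v`, an automorphism — left translations are automorphisms, `leftMulIso` — fixing `1`). [cite: BartholdiErschler2012, §2–§3.1] [cite: BenjaminiSchramm1996, §2] -/
theorem aut_eq_leftMul_flipAut (α : Cay ≃g Cay) : ∃ P : Ray → Prop, ∀ v : ↥wreathZ, α v = α 1 * flipW P v := by
  set β : Cay ≃g Cay := α.trans (leftMulIso stdGens (α 1)⁻¹) with hβ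
  have hβv : ∀ v, β v = (α 1)⁻¹ * α v := fun v => rfl
  obtain ⟨P, hP⟩ := aut_eq_flipAut_of_map_one β (by rw [hβv, inv_mul_cancel])
  refine ⟨P, fun v => ?_⟩
  have e : β v = flipW P v := by rw [hP]; rfl
  rw [hβv] at e
  rw [← e, mul_inv_cancel_left]

/-- **THE VERTEX STABILISER OF `Cay(ℤ ≀_X 𝔊; a,b,c,d,s)` IS EXACTLY THE SET OF SIGN PATTERNS** (`⊆`: the theorem above; `⊇`: S's `flipAut_one`) — so
`Aut(Cay) = Γ₂ · {±1}^{positions}`: the left translations composed with the position-wise lamp reflections, and nothing else. [cite: BartholdiErschler2012, §2–§3.1]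
[cite: BenjaminiSchramm1996, §2] -/
theorem stabilizer_one_eq_range_flipAut : {α : Cay ≃g Cay | α 1 = 1} = Set.range flipAut := by
  ext α
  constructor
  · intro h
    obtain ⟨P, hP⟩ := aut_eq_flipAut_of_map_one α h
    exact ⟨P, hP.symm⟩
  · rintro ⟨P, rfl⟩
    exact flipAut_one P

end Grigorchuk
end Summit.CriticalPhenomena.PercolationContinuityZ3.Theorems.Transplant
end
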